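import Summits.ABC.ABC.Theorems.TwistAmplificationSharpModerateLawTwistMinimalDefs
import Summits.ABC.ABC.Theorems.TwistAmplificationSharpModerateLawCoreTransfer
import Literature.NumberTheory.CubicFields.UniformityFieldReduction

/-!
# Crux `TwistAmplification.SharpModerateLaw` (stmt-ABC-1975): the twist-orbit inversion — counting lemmas

Lead `prover-line-stmt-ABC-1975-c6-0`, skeleton v5 (line `unit-plane-conic-two-torsion`, reshaped), stub
`stub_inversion : TwistDecomposition → TwistScaling → TwistOrbitInversion` (file `…TwistMinimalInversion.lean`).
This file carries the elementary lemmas of that proof: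

* `one_le_n5cusp` — the conductor proxy is `≥ 1`;
* `cuspShell_subset_biUnion_twist` — the COVER: by `TwistDecomposition`/`TwistScaling` every pair of `cuspShell X Y`
  is `d ⋆ x'` with `1 ≤ d`, `d² ≤ X` and `x'` a twist-minimal pair of `cuspShell (X/d²) (Y/d⁶)`;
* `ncard_cuspShell_le_sum_twist` — hence `#cuspShell(X, Y) ≤ Σ_{d² ≤ X} #(TM ∩ cuspShell(X/d², Y/d⁶))`;
* `twistFibre_main` — the MAIN-TERM fibres: for `Y/d⁶ ≤ (X/d²)^{σ₁}` the twist-minimal law at `(κ₁, σ₁)` bounds the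
  fibre by `C₁ (XY)^{ε} (X·Y^{-1/6}/d + 1)` (the cone's lower edge survives because `κ₁ ≥ 3`);
* `twistFibre_tail` — the TAIL fibres: for `Y/d⁶ > (X/d²)^{6+2η}` pointwise Szpiro at `η` puts the fibre in a fixed
  finite box and forces `d < D_B`.
-/

noncomputable section

-- the mandated summit namespace `Summit.ABC.ABC` (summit = problem) trips the duplicate-namespace linter
set_option linter.dupNamespace false

namespace Summit.ABC.ABC.Theorems.SharpModerateLaw

open Finset

/-! ## 1. Generic counting -/

/-- The conductor proxy `N5cusp` is a product of primes and prime squares, hence `≥ 1`. -/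
theorem one_le_n5cusp (x : ℤ × ℤ) : 1 ≤ N5cusp x := by
  unfold N5cusp
  refine Nat.one_le_iff_ne_zero.mpr (Finset.prod_ne_zero_iff.mpr fun p hp => ?_)
  have hp' : p.Prime := Nat.prime_of_mem_primeFactors (Finset.mem_filter.mp hp).1
  split_ifs
  · exact pow_ne_zero _ hp'.ne_zero
  · exact hp'.ne_zero

/-! ## 2. The cover of a cusp shell by twisted twist-minimal shells -/

/-- **The cover.** Under `TwistDecomposition` and `TwistScaling`, every `x ∈ cuspShell X Y` is `d ⋆ x'` for some
`d` with `1 ≤ d`, `d² ≤ X` (recorded as `d ≤ Nat.sqrt ⌊X⌋₊`) and some twist-minimal `x' ∈ cuspShell (X/d²) (Y/d⁶)`. -/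
theorem cuspShell_subset_biUnion_twist (hdec : TwistDecomposition) (hsc : TwistScaling) (X Y : ℝ) :
    cuspShell X Y ⊆ ⋃ d ∈ Finset.Icc 1 (Nat.sqrt ⌊X⌋₊),
      (fun x' => twistPair (d : ℤ) x') ''
        {x' : ℤ × ℤ | x' ∈ cuspShell (X / (d : ℝ) ^ 2) (Y / (d : ℝ) ^ 6) ∧ IsTwistMinimal x'} := by
  intro x hx
  obtain ⟨h1, h2, h3, h1728, hTF, hYle, hltY, hN⟩ := hx
  obtain ⟨d, x', hd1, hsq, hprimes, hxeq, hTM, hTF', h1728'⟩ := hdec x h3 h1728 hTF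
  -- the twisted pair has the same non-vanishing
  have hd0 : (d : ℤ) ≠ 0 := by exact_mod_cast Nat.one_le_iff_ne_zero.mp hd1
  have hx1 : x.1 = (d : ℤ) ^ 2 * x'.1 := by rw [hxeq]; rfl
  have hx2 : x.2 = (d : ℤ) ^ 3 * x'.2 := by rw [hxeq]; rfl
  have h1' : x'.1 ≠ 0 := by
    intro h; apply h1; rw [hx1, h, mul_zero]
  have h2' : x'.2 ≠ 0 := by
    intro h; apply h2; rw [hx2, h, mul_zero]
  have h3' : x'.1 ^ 3 ≠ x'.2 ^ 2 := by
    intro h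
    apply h3
    have := twistPair_cube_sub_sq (d : ℤ) x'
    rw [← hxeq] at this
    rw [← sub_eq_zero, this, h, sub_self, mul_zero]
  obtain ⟨hM, hN5⟩ := hsc d x' hd1 hsq hprimes h3' h1728'
  rw [← hxeq] at hM hN5
  -- real-number forms of the scalings
  have hdR1 : (1 : ℝ) ≤ d := by exact_mod_cast hd1
  have hdR0 : (0 : ℝ) < d := by linarith
  have hd2 : (0 : ℝ) < (d : ℝ) ^ 2 := by positivity
  have hd6 : (0 : ℝ) < (d : ℝ) ^ 6 := by positivity
  have hMR : (Mcusp x : ℝ) = (d : ℝ) ^ 6 * (Mcusp x' : ℝ) := by exact_mod_cast hM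
  have hNR : (N5cusp x : ℝ) = (d : ℝ) ^ 2 * (N5cusp x' : ℝ) := by exact_mod_cast hN5
  have hN1 : (1 : ℝ) ≤ (N5cusp x' : ℝ) := by exact_mod_cast one_le_n5cusp x'
  -- `d² ≤ X`
  have hd2X : (d : ℝ) ^ 2 ≤ X := by
    have : (d : ℝ) ^ 2 * 1 ≤ (d : ℝ) ^ 2 * (N5cusp x' : ℝ) := mul_le_mul_of_nonneg_left hN1 hd2.le
    linarith [hNR ▸ hN]
  refine Set.mem_iUnion₂.mpr ⟨d, ?_, ⟨x', ⟨⟨h1', h2', h3', h1728', hTF', ?_, ?_, ?_⟩, hTM⟩, hxeq.symm⟩⟩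
  · -- `d ∈ Icc 1 (Nat.sqrt ⌊X⌋₊)`
    refine Finset.mem_Icc.mpr ⟨hd1, Nat.le_sqrt.mpr (Nat.le_floor ?_)⟩
    push_cast
    nlinarith
  · -- `Y/d⁶ ≤ M⁺(x')`
    rw [div_le_iff₀ hd6]
    calc Y ≤ (Mcusp x : ℝ) := hYle
      _ = (Mcusp x' : ℝ) * (d : ℝ) ^ 6 := by rw [hMR, mul_comm]
  · -- `M⁺(x') < 2Y/d⁶`
    rw [← mul_div_assoc, lt_div_iff₀ hd6]
    calc (Mcusp x' : ℝ) * (d : ℝ) ^ 6 = (Mcusp x : ℝ) := by rw [hMR, mul_comm]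
      _ < 2 * Y := hltY
  · -- `N5cusp x' ≤ X/d²`
    rw [le_div_iff₀ hd2]
    calc (N5cusp x' : ℝ) * (d : ℝ) ^ 2 = (N5cusp x : ℝ) := by rw [hNR, mul_comm]
      _ ≤ X := hN

/-- **Counting through the cover**: `#cuspShell(X, Y) ≤ Σ_{1 ≤ d, d² ≤ X} #(TM ∩ cuspShell(X/d², Y/d⁶))`
(the twist `x' ↦ d ⋆ x'` is injective for `d ≠ 0`, so images do not exceed fibres). -/
theorem ncard_cuspShell_le_sum_twist (hdec : TwistDecomposition) (hsc : TwistScaling) (X Y : ℝ) :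
    (cuspShell X Y).ncard ≤ ∑ d ∈ Finset.Icc 1 (Nat.sqrt ⌊X⌋₊),
      {x' : ℤ × ℤ | x' ∈ cuspShell (X / (d : ℝ) ^ 2) (Y / (d : ℝ) ^ 6) ∧ IsTwistMinimal x'}.ncard := by
  classical
  have hfin : ∀ d : ℕ, ({x' : ℤ × ℤ | x' ∈ cuspShell (X / (d : ℝ) ^ 2) (Y / (d : ℝ) ^ 6) ∧
      IsTwistMinimal x'}).Finite :=
    fun d => (cuspShell_finite _ _).subset fun x hx => hx.1
  have hU : (⋃ d ∈ Finset.Icc 1 (Nat.sqrt ⌊X⌋₊), (fun x' => twistPair (d : ℤ) x') ''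
      {x' : ℤ × ℤ | x' ∈ cuspShell (X / (d : ℝ) ^ 2) (Y / (d : ℝ) ^ 6) ∧ IsTwistMinimal x'}).Finite :=
    Set.Finite.biUnion (Finset.finite_toSet _) fun d _ => (hfin d).image _
  calc (cuspShell X Y).ncard
      ≤ (⋃ d ∈ Finset.Icc 1 (Nat.sqrt ⌊X⌋₊), (fun x' => twistPair (d : ℤ) x') ''
          {x' : ℤ × ℤ | x' ∈ cuspShell (X / (d : ℝ) ^ 2) (Y / (d : ℝ) ^ 6) ∧ IsTwistMinimal x'}).ncard :=
        Set.ncard_le_ncard (cuspShell_subset_biUnion_twist hdec hsc X Y) hU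
    _ ≤ ∑ d ∈ Finset.Icc 1 (Nat.sqrt ⌊X⌋₊), ((fun x' => twistPair (d : ℤ) x') ''
          {x' : ℤ × ℤ | x' ∈ cuspShell (X / (d : ℝ) ^ 2) (Y / (d : ℝ) ^ 6) ∧ IsTwistMinimal x'}).ncard :=
        Literature.NumberTheory.CubicFields.ncard_biUnion_le_sum _ _
    _ ≤ _ := Finset.sum_le_sum fun d _ => Set.ncard_image_le (hfin d)

/-- Registered sub-goal `inversionLemmas_main` of stmt-ABC-1975 (the cover count, closed form of
`ncard_cuspShell_le_sum_twist`). -/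
theorem inversionLemmas_main : TwistDecomposition → TwistScaling → ∀ X Y : ℝ,
    (cuspShell X Y).ncard ≤ ∑ d ∈ Finset.Icc 1 (Nat.sqrt ⌊X⌋₊),
      {x' : ℤ × ℤ | x' ∈ cuspShell (X / (d : ℝ) ^ 2) (Y / (d : ℝ) ^ 6) ∧ IsTwistMinimal x'}.ncard :=
  fun hdec hsc X Y => ncard_cuspShell_le_sum_twist hdec hsc X Y

/-! ## 3. The main-term fibres: the twist-minimal law on the cone -/

/-- `(Y/d⁶)^{-1/6} = Y^{-1/6} · d` for `d > 0`, `Y ≥ 0`. -/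
theorem div_pow_six_rpow_neg_sixth {Y d : ℝ} (hY : 0 ≤ Y) (hd : 0 < d) :
    (Y / d ^ 6) ^ (-(1 / 6 : ℝ)) = Y ^ (-(1 / 6 : ℝ)) * d := by
  rw [Real.div_rpow hY (by positivity), div_eq_mul_inv]
  congr 1
  rw [← Real.rpow_natCast d 6, ← Real.rpow_mul hd.le, ← Real.rpow_neg_one, ← Real.rpow_mul hd.le]
  norm_num

/-- **Main-term fibre bound.** If `CoreLawTM` holds at `(κ₁, σ₁, ε)` with constant `C₁ ≥ 0`, `3 ≤ κ₁`, `X^{κ₁} ≤ Y`,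
`1 ≤ d`, `d² ≤ X` and the fibre is under the cap `Y/d⁶ ≤ (X/d²)^{σ₁}`, then
`#(TM ∩ cuspShell(X/d², Y/d⁶)) ≤ C₁ (XY)^ε (X·Y^{-1/6}/d + 1)`. -/
theorem twistFibre_main {κ₁ σ₁ ε C₁ X Y : ℝ} {d : ℕ}
    (hC : ∀ X Y : ℝ, 1 ≤ X → 1 ≤ Y → X ^ κ₁ ≤ Y → Y ≤ X ^ σ₁ →
      (Set.ncard {x : ℤ × ℤ | x ∈ cuspShell X Y ∧ IsTwistMinimal x} : ℝ) ≤
        C₁ * (X * Y) ^ ε * (X * Y ^ (-(1 / 6 : ℝ)) + 1))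
    (hC₁ : 0 ≤ C₁) (hε : 0 ≤ ε) (hκ₁ : 3 ≤ κ₁) (hX : 1 ≤ X) (hXY : X ^ κ₁ ≤ Y) (hd : 1 ≤ d)
    (hdX : (d : ℝ) ^ 2 ≤ X) (hcap : Y / (d : ℝ) ^ 6 ≤ (X / (d : ℝ) ^ 2) ^ σ₁) :
    (Set.ncard {x' : ℤ × ℤ | x' ∈ cuspShell (X / (d : ℝ) ^ 2) (Y / (d : ℝ) ^ 6) ∧ IsTwistMinimal x'} : ℝ) ≤
      C₁ * (X * Y) ^ ε * (X * Y ^ (-(1 / 6 : ℝ)) / d + 1) := by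
  have hdR1 : (1 : ℝ) ≤ d := by exact_mod_cast hd
  have hdR0 : (0 : ℝ) < d := by linarith
  have hd2 : (0 : ℝ) < (d : ℝ) ^ 2 := by positivity
  have hd6 : (0 : ℝ) < (d : ℝ) ^ 6 := by positivity
  have hX0 : 0 < X := by linarith
  have hX3 : X ^ (3 : ℝ) ≤ Y := le_trans (Real.rpow_le_rpow_of_exponent_le hX hκ₁) hXY
  have hY1 : 1 ≤ Y := le_trans (Real.one_le_rpow hX (by norm_num)) hX3
  have hY0 : 0 < Y := by linarith
  -- the fibre parameters
  have hXd : 1 ≤ X / (d : ℝ) ^ 2 := by rwa [le_div_iff₀ hd2, one_mul]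
  have hd6X : (d : ℝ) ^ 6 ≤ Y := by
    have h1 : (d : ℝ) ^ 6 = ((d : ℝ) ^ 2) ^ (3 : ℕ) := by ring
    have h2 : ((d : ℝ) ^ 2) ^ (3 : ℕ) ≤ X ^ (3 : ℕ) := pow_le_pow_left₀ hd2.le hdX 3
    have h3 : X ^ (3 : ℕ) = X ^ (3 : ℝ) := by rw [← Real.rpow_natCast]; norm_num
    rw [h1]; exact h2.trans (h3.le.trans hX3)
  have hYd : 1 ≤ Y / (d : ℝ) ^ 6 := by rwa [le_div_iff₀ hd6, one_mul]
  have hlow : (X / (d : ℝ) ^ 2) ^ κ₁ ≤ Y / (d : ℝ) ^ 6 := by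
    rw [Real.div_rpow hX0.le hd2.le, div_le_div_iff₀ (Real.rpow_pos_of_pos hd2 κ₁) hd6]
    -- `X^{κ₁} d⁶ ≤ Y (d²)^{κ₁}` since `d⁶ ≤ (d²)^{κ₁}` and `X^{κ₁} ≤ Y`
    have h1 : (d : ℝ) ^ 6 ≤ ((d : ℝ) ^ 2) ^ κ₁ := by
      have : (d : ℝ) ^ 6 = ((d : ℝ) ^ 2) ^ (3 : ℝ) := by
        rw [show (3 : ℝ) = ((3 : ℕ) : ℝ) by norm_num, Real.rpow_natCast]; ring
      rw [this]
      exact Real.rpow_le_rpow_of_exponent_le (by nlinarith) hκ₁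
    calc X ^ κ₁ * (d : ℝ) ^ 6 ≤ Y * (d : ℝ) ^ 6 := mul_le_mul_of_nonneg_right hXY hd6.le
      _ ≤ Y * ((d : ℝ) ^ 2) ^ κ₁ := mul_le_mul_of_nonneg_left h1 hY0.le
  have key := hC (X / (d : ℝ) ^ 2) (Y / (d : ℝ) ^ 6) hXd hYd hlow hcap
  -- compare the right-hand sides
  have hprod : (X / (d : ℝ) ^ 2 * (Y / (d : ℝ) ^ 6)) ^ ε ≤ (X * Y) ^ ε := by
    apply Real.rpow_le_rpow (by positivity) _ hε
    rw [div_mul_div_comm, div_le_iff₀ (by positivity)]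
    have : (1 : ℝ) ≤ (d : ℝ) ^ 2 * (d : ℝ) ^ 6 :=
      one_le_mul_of_one_le_of_one_le (one_le_pow₀ hdR1) (one_le_pow₀ hdR1)
    nlinarith [mul_pos hX0 hY0]
  have hmain : X / (d : ℝ) ^ 2 * (Y / (d : ℝ) ^ 6) ^ (-(1 / 6 : ℝ)) = X * Y ^ (-(1 / 6 : ℝ)) / d := by
    rw [div_pow_six_rpow_neg_sixth hY0.le hdR0]
    field_simp
  rw [hmain] at key
  calc _ ≤ C₁ * (X / (d : ℝ) ^ 2 * (Y / (d : ℝ) ^ 6)) ^ ε * (X * Y ^ (-(1 / 6 : ℝ)) / d + 1) := key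
    _ ≤ C₁ * (X * Y) ^ ε * (X * Y ^ (-(1 / 6 : ℝ)) / d + 1) := by
        apply mul_le_mul_of_nonneg_right (mul_le_mul_of_nonneg_left hprod hC₁)
        positivity

/-! ## 4. The tail fibres: pointwise Szpiro beyond the cap -/

/-- **Tail fibre, box.** If pointwise Szpiro holds at `η > 0` with constant `C₂ > 0`, `1 ≤ X/d²` and the fibre is beyond
the cap, `(X/d²)^{6+2η} < Y/d⁶`, then every twist-minimal `x' ∈ cuspShell (X/d²) (Y/d⁶)` lies in the fixed box
`{1728 ∣ u³ − v², M⁺ < C₂ · (C₂^{1/η})^{6+η}}`. -/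
theorem twistFibre_tail_subset {η C₂ X Y : ℝ} {d : ℕ} (hη : 0 < η) (hC₂ : 0 < C₂)
    (hPW : ∀ x : ℤ × ℤ, x.1 ≠ 0 → x.2 ≠ 0 → x.1 ^ 3 ≠ x.2 ^ 2 → (1728 : ℤ) ∣ x.1 ^ 3 - x.2 ^ 2 → TF x →
      (Mcusp x : ℝ) ≤ C₂ * (N5cusp x : ℝ) ^ (6 + η))
    (hXd : 1 ≤ X / (d : ℝ) ^ 2) (hcap : (X / (d : ℝ) ^ 2) ^ (6 + 2 * η) < Y / (d : ℝ) ^ 6) :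
    {x' : ℤ × ℤ | x' ∈ cuspShell (X / (d : ℝ) ^ 2) (Y / (d : ℝ) ^ 6) ∧ IsTwistMinimal x'} ⊆
      {x' : ℤ × ℤ | (1728 : ℤ) ∣ x'.1 ^ 3 - x'.2 ^ 2 ∧
        (Mcusp x' : ℝ) < C₂ * (C₂ ^ (1 / η)) ^ (6 + η) + 1} := by
  rintro x' ⟨⟨h1, h2, h3, h1728, hTF, hYle, -, hN⟩, -⟩
  refine ⟨h1728, ?_⟩
  set Xd : ℝ := X / (d : ℝ) ^ 2 with hXd_def
  have hXd0 : 0 < Xd := by linarith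
  have hpw := hPW x' h1 h2 h3 h1728 hTF
  have hN0 : (0 : ℝ) ≤ (N5cusp x' : ℝ) := Nat.cast_nonneg _
  have h6η : (0 : ℝ) ≤ 6 + η := by linarith
  -- `Xd^{6+2η} < Y/d⁶ ≤ M⁺ ≤ C₂ N5^{6+η} ≤ C₂ Xd^{6+η}`, so `Xd^η < C₂`
  have hchain : Xd ^ (6 + 2 * η) < C₂ * Xd ^ (6 + η) :=
    calc Xd ^ (6 + 2 * η) < Y / (d : ℝ) ^ 6 := hcap
      _ ≤ (Mcusp x' : ℝ) := hYle
      _ ≤ C₂ * (N5cusp x' : ℝ) ^ (6 + η) := hpw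
      _ ≤ C₂ * Xd ^ (6 + η) := mul_le_mul_of_nonneg_left (Real.rpow_le_rpow hN0 hN h6η) hC₂.le
  have hXdη : Xd ^ η < C₂ := by
    have hsplit : Xd ^ (6 + 2 * η) = Xd ^ η * Xd ^ (6 + η) := by
      rw [← Real.rpow_add hXd0]; congr 1; ring
    rw [hsplit] at hchain
    exact lt_of_mul_lt_mul_right hchain (Real.rpow_nonneg hXd0.le _)
  -- hence `Xd < C₂^{1/η}` and `N5 < C₂^{1/η}`
  have hXdB : Xd < C₂ ^ (1 / η) := by
    by_contra hle
    push Not at hle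
    have : C₂ ≤ Xd ^ η := by
      calc C₂ = (C₂ ^ (1 / η)) ^ η := by
            rw [← Real.rpow_mul hC₂.le, one_div_mul_cancel hη.ne', Real.rpow_one]
        _ ≤ Xd ^ η := Real.rpow_le_rpow (Real.rpow_nonneg hC₂.le _) hle hη.le
    linarith
  have hNB : (N5cusp x' : ℝ) < C₂ ^ (1 / η) := lt_of_le_of_lt hN hXdB
  calc (Mcusp x' : ℝ) ≤ C₂ * (N5cusp x' : ℝ) ^ (6 + η) := hpw
    _ ≤ C₂ * (C₂ ^ (1 / η)) ^ (6 + η) :=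
        mul_le_mul_of_nonneg_left (Real.rpow_le_rpow hN0 hNB.le h6η) hC₂.le
    _ < C₂ * (C₂ ^ (1 / η)) ^ (6 + η) + 1 := lt_add_one _

/-- **Tail fibre, range of `d`.** In the same situation, if moreover `3 < κ₁`, `X^{κ₁} ≤ Y`, `1 ≤ d`, `d² ≤ X` and the
fibre is NONEMPTY, then `d < (C₂ (C₂^{1/η})^{6+η} + 1)^{1/(2κ₁−6)}`: from `d^{2κ₁} ≤ X^{κ₁} ≤ Y ≤ d⁶ M⁺(x')`. -/
theorem twistFibre_tail_d_lt {η C₂ κ₁ X Y : ℝ} {d : ℕ} (hη : 0 < η) (hC₂ : 0 < C₂)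
    (hPW : ∀ x : ℤ × ℤ, x.1 ≠ 0 → x.2 ≠ 0 → x.1 ^ 3 ≠ x.2 ^ 2 → (1728 : ℤ) ∣ x.1 ^ 3 - x.2 ^ 2 → TF x →
      (Mcusp x : ℝ) ≤ C₂ * (N5cusp x : ℝ) ^ (6 + η))
    (hκ₁ : 3 < κ₁) (hXY : X ^ κ₁ ≤ Y) (hd : 1 ≤ d) (hdX : (d : ℝ) ^ 2 ≤ X)
    (hcap : (X / (d : ℝ) ^ 2) ^ (6 + 2 * η) < Y / (d : ℝ) ^ 6)
    (hne : {x' : ℤ × ℤ | x' ∈ cuspShell (X / (d : ℝ) ^ 2) (Y / (d : ℝ) ^ 6) ∧ IsTwistMinimal x'}.Nonempty) :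
    (d : ℝ) < (C₂ * (C₂ ^ (1 / η)) ^ (6 + η) + 1) ^ (1 / (2 * κ₁ - 6)) := by
  obtain ⟨x', hx'⟩ := hne
  have hdR1 : (1 : ℝ) ≤ d := by exact_mod_cast hd
  have hdR0 : (0 : ℝ) < d := by linarith
  have hd2 : (0 : ℝ) < (d : ℝ) ^ 2 := by positivity
  have hd6 : (0 : ℝ) < (d : ℝ) ^ 6 := by positivity
  have hXd : 1 ≤ X / (d : ℝ) ^ 2 := by rwa [le_div_iff₀ hd2, one_mul]
  have hbox := twistFibre_tail_subset hη hC₂ hPW hXd hcap hx'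
  set B' : ℝ := C₂ * (C₂ ^ (1 / η)) ^ (6 + η) + 1 with hB'
  have hB'0 : 0 < B' := by positivity
  have hM : (Mcusp x' : ℝ) < B' := hbox.2
  have hYle : Y / (d : ℝ) ^ 6 ≤ (Mcusp x' : ℝ) := hx'.1.2.2.2.2.2.1
  -- `d^{2κ₁} ≤ X^{κ₁} ≤ Y < d⁶ B'`
  have h1 : ((d : ℝ) ^ 2) ^ κ₁ ≤ Y := le_trans (Real.rpow_le_rpow hd2.le hdX (by linarith)) hXY
  have h2 : Y < (d : ℝ) ^ 6 * B' := by
    have := (div_le_iff₀ hd6).mp hYle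
    nlinarith
  have hexp : 0 < 2 * κ₁ - 6 := by linarith
  -- so `d^{2κ₁ - 6} < B'`
  have h3 : (d : ℝ) ^ (2 * κ₁ - 6) < B' := by
    have hsplit : ((d : ℝ) ^ 2) ^ κ₁ = (d : ℝ) ^ (2 * κ₁ - 6) * (d : ℝ) ^ 6 := by
      rw [← Real.rpow_natCast d 2, ← Real.rpow_mul hdR0.le, ← Real.rpow_natCast d 6,
        ← Real.rpow_add hdR0]
      congr 1; push_cast; ring
    rw [hsplit] at h1
    have h4 : (d : ℝ) ^ (2 * κ₁ - 6) * (d : ℝ) ^ 6 < B' * (d : ℝ) ^ 6 := by linarith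
    exact lt_of_mul_lt_mul_right h4 hd6.le
  by_contra hle
  push Not at hle
  have : B' ≤ (d : ℝ) ^ (2 * κ₁ - 6) := by
    calc B' = (B' ^ (1 / (2 * κ₁ - 6))) ^ (2 * κ₁ - 6) := by
          rw [← Real.rpow_mul hB'0.le, one_div_mul_cancel hexp.ne', Real.rpow_one]
      _ ≤ (d : ℝ) ^ (2 * κ₁ - 6) := Real.rpow_le_rpow (Real.rpow_nonneg hB'0.le _) hle hexp.le
  linarith

end Summit.ABC.ABC.Theorems.SharpModerateLaw

end
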